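import Summits.BirchSwinnertonDyer.BirchSwinnertonDyer.Theorems.RamifiedHeegnerPairLeafShimuraInertSavingDischarged
import HarnessLib

/-!
# Route `RamifiedHeegnerPair`, cruxes U₁ `LeafRankOneUpperAtThree` (stmt-BirchSwinnertonDyer-26022) ∕ U₀ (26024), line
# `partnerdescent` — the (DISPLAY) stub's KOLYVAGIN ORDER CLAUSE IS A THEOREM OF THE LABELS (partner kernel part 6)

HONEST FRAMING. Theorems only; helper file (`--supports stmt-BirchSwinnertonDyer-26022 --as helper`); no definition, no named
fact, no `sorry`; nothing is booked, no item closes; CONDITIONAL on every displayed input; BSD is proved for no curve. Lead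
prover bsd-line-rhp-p2 g56, 2026-08-30.

WHY. The registered line `partnerdescent` (v2 ∕ v3, skeleton `Cruxes/LeafRankOneUpperAtThree/Lines/partnerdescent.lean`) carries the
print-composite stub (DISPLAY) `stub_partnerGenusDisplayAtThree`: for the leaf curve `W` and the `3`-good twist partner `V`, at
`V`'s class-minimal Shimura datum, a point `P ∈ E(K)` and `degS ≥ 1` with `ord₃ degS = ord₃ deg P₀`, the REAL Gross–Zagier display
`degS·L′(E/K,1) = (2covol(Λ_E)·deg(D₀)/(c(D₀)²(w_K/2)²√|d_K|))·ĥ_K(P)`, AND the plain Kolyvagin ORDER CLAUSE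
`P ∉ E(K)_tors ⇒ #Ш(E/K)[3^∞] ≤ 3^{2·ord₃[E(K):ℤP]}`. Its docstring flagged the order clause as the one research-grade worry
(«the χ-twisted Kolyvagin machine at `p = 3 = c`»). THIS FILE removes it: the order clause is a THEOREM of the tree's image-keyed
Kolyvagin machine (`ShimuraKolyvaginOfImage.padicValNat_card_sha_primary_add_le_of_shimuraLabels_ofImage_of_casselsTate_of_divLab_of_not_dvd_discr`,
part R2 of this line's saving road, run at saving depth `t = 0` where its (DIV) clause is vacuous) once the point `P` is the
bottom of a family `ys : m ↦ E(K[m])` carrying the printed LABELS (B2)–(B5) of `ShimuraWalk.LabelsAt` — Gross (4.1) bottom,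
Gross 5.3 complex conjugation, Gross 3.7 (1) norm and 3.7 (2) congruence relations FOR `W`. The image inputs at `3` come from
`E[3]` irreducible (the Gss2 cell) and `3 ∤ d_K` (`3` is additive for `E`, hence outside the inert set, hence split); the index
guard (`0 < [E(K):ℤP]` for non-torsion `P`) comes from the display itself (`L′(E/K,1) ≠ 0`: the constant is a product of
non-zero reals — covolume, modular degree, Manin constant `≠ 0` by `maninConstant_ne_zero_holds`) with GZK over `ℚ` and modularity
(`mordellWeilRank_baseChange_eq_one_of_LDerivEK_ne_zero`); the Cassels–Tate level inputs are the kernel theorem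
`ShaTwoCochainTheta.casselsTate_levelInputs_of_readout_vanishing_flip` (cell bsd-wall's Ш²-cochain bridge).

WHAT THE RESHAPED STUB (DISPLAY-L) THEN SAYS (skeleton v4 of the line): the same display, and «`P` is the bottom of a labelled family
for `W` over the ring class tower of `K`» — which is what the genus descent GIVES: with `ψ : W ≅ V` the twist isomorphism over
`ℚ(√−3)`, `σ` the generator of `Gal(K[3m]/K[m])` (`3` split in `K`, `3 ∤ m`: `K[3m] = K[m](√−3)`), and `χ₋₃(m) = ∏_{ℓ ∣ m}(−3/ℓ)`, the
RE-SIGNED descended family `z_m := χ₋₃(m)·ψ⁻¹((1 − σ)·y_{3m}(V)) ∈ W(K[m])` satisfies (B4) `Tr z_{mℓ} = a_ℓ(W)·z_m` and (B5)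
`red z_{mℓ} = Frob·red z_m` EXACTLY (the two signs `a_ℓ(V) = (−3/ℓ)·a_ℓ(W)` and `ψ̃^{Frob_ℓ} = (−3/ℓ)·ψ̃` are the same sign and are
absorbed by the re-signing), (B3) with `ε_W = −ε_V` (`χ₋₃(complex conjugation) = −1`), and (B2) with `P := Tr_{K[1]/K} z_1 = ψ⁻¹(e_χ y_3)`,
the genus component whose height Cai–Shu–Tian's Thm. 1.5 (`c = 3` coprime to `N_V·d_K`) displays. So (DISPLAY-L) is generation-level
print (CM points on `X^{∏S}_0(N_V/∏S)` and their Gross ∕ Nekovář relations) plus the explicit Gross–Zagier formula; the DESCENT is here.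

* §1 `natCard_le_pow_of_padicValNat_le` — a `3`-group count: `#A[3^∞] ≤ 3^k` once `ord₃ #A[3^∞] ≤ k` (or `A[3^∞]` infinite, count `0`).
* §2 `LDerivEK_ne_zero_of_realDisplay` ∕ `index_pos_of_realDisplay_of_GZK` — the index guard from the REAL display.
* §3 `orderClause_of_labels` — the plain Kolyvagin order clause at `3` for the bottom of a labelled `W`-family on the partner frame
  (`E[3]` irreducible, `3 ∣ N`, `S` inert-unramified and multiplicative, the rest of `N` split).
* §4 `partnerGenusDisplay_of_labelled_of_GZK_of_modularity` — **(DISPLAY) ⟸ (DISPLAY-L) ∧ GZK ∧ modularity**, bodies VERBATIM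
  (the workfile predicates `Partnerdescent.PartnerGenusDisplayAtThree` ∕ `…LabelledAtThree` unfold to them definitionally).
-- §3 adapted from Summits/…/Theorems/RamifiedHeegnerPairLeafShimuraSavedDisplaySplitAtThree.lean §2 (this lineage, g11) at `t = 0`.
References (locators only): [cite: GrossLMS1991, §3 Prop. 3.7, §4 (4.1), §5 Prop. 5.3] [cite: McCallumLMS1991, §1 Theorem (Kolyvagin), §5 Cor. 5.6]
[cite: MatarNekovar2019, Thm. 0.7 (p. 456)] [cite: CaiShuTian2014, Thm. 1.5] [cite: BertoliniDarmon1990, §2] [cite: Nekovar2007, (4.8)–(4.9)]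
[cite: MilneADT2006, Ch. I Thm. 4.10(b), Thm. 6.13(a)].
presearch: «Kolyvagin bound for the genus-character component of Heegner points ∕ twisted Heegner system sign» → [corpus:paper:arxiv-1407.1099]
(Heegner points in the multiplicative case; no genus descent at p = 3), Bertolini–Darmon 1990 (ring-class descent, in print; sign bookkeeping not
printed) — none states the re-signed labels; tree: the OfImage machine (above). Axioms: `propext`, `Classical.choice`, `Quot.sound`.
-/

set_option autoImplicit false
set_option linter.dupNamespace false

noncomputable section

open scoped Classical NumberField

namespace Summit.BirchSwinnertonDyer.BirchSwinnertonDyer.Theorems.LeafPartnerDisplay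

open WeierstrassCurve NumberField IsDedekindDomain Literature Literature.NumberTheory.EllipticCurves
  Rat.HeightOneSpectrum CongruenceSubgroup
  Literature.NumberTheory.EllipticCurves.ModularForms
  Literature.NumberTheory.EllipticCurves.Rank1Residual
  Literature.NumberTheory.EllipticCurves.Rank1Residual.Typed
  Literature.NumberTheory.EllipticCurves.RingClassField
  Literature.NumberTheory.QuadraticFields.Quadratic
  Literature.NumberTheory.GaloisCohomology
  Literature.NumberTheory.GaloisRepresentations
  Literature.NumberTheory.Automorphic
  Summit.BirchSwinnertonDyer.Rank1Residual
  Summit.BirchSwinnertonDyer.Rank1Residual.Additive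
  Summit.BirchSwinnertonDyer.Rank1Residual.X11b
  Summit.BirchSwinnertonDyer.Rank1Residual.X11b.Three
  Summit.BirchSwinnertonDyer.BirchSwinnertonDyer.Theorems
  Summit.BirchSwinnertonDyer.BirchSwinnertonDyer.Theorems.ShimuraKolyvaginTransport

/-! ## §1 A `p`-group count -/

/-- **`#A[3^∞] ≤ 3^k` from `ord₃ #A[3^∞] ≤ k`**: the `3`-primary component, if finite, is a `3`-group, so its order is
`3^{ord₃ #A[3^∞]}` (Lagrange–Cauchy, `IsPGroup.iff_card`); if infinite its `Nat.card` is `0`. [folklore] -/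
theorem natCard_le_pow_of_padicValNat_le (A : Type*) [AddCommGroup A] {k : ℕ}
    (h : padicValNat 3 (Nat.card (AddCommGroup.primaryComponent A 3)) ≤ k) :
    Nat.card (AddCommGroup.primaryComponent A 3) ≤ 3 ^ k := by
  by_cases h0 : Nat.card (AddCommGroup.primaryComponent A 3) = 0
  · rw [h0]; exact Nat.zero_le _
  haveI : Finite (AddCommGroup.primaryComponent A 3) := Nat.finite_of_card_ne_zero h0
  haveI : Fact (Nat.Prime 3) := ⟨Nat.prime_three⟩
  have hPG : IsPGroup 3 (Multiplicative (AddCommGroup.primaryComponent A 3)) := fun g ↦ by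
    obtain ⟨m, hm⟩ := (AddCommGroup.mem_primaryComponent).mp (Multiplicative.toAdd g).2
    refine ⟨m, ?_⟩
    apply Multiplicative.toAdd.injective
    rw [toAdd_pow, toAdd_one]
    exact Subtype.ext (by rw [AddSubmonoidClass.coe_nsmul, hm]; rfl)
  obtain ⟨v, hv⟩ := IsPGroup.iff_card.mp hPG
  have hv' : Nat.card (AddCommGroup.primaryComponent A 3) = 3 ^ v := hv
  rw [hv'] at h ⊢
  rw [padicValNat.prime_pow] at h
  exact Nat.pow_le_pow_right (by norm_num) h

/-! ## §2 The index guard from the REAL display -/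

/-- **`L′(E/K,1) ≠ 0` from a real display at a non-torsion point**: `degS·L′(E/K,1) = (2covol(Λ_E)·deg/(c²(w/2)²√|d_K|))·ĥ(P)`
with covolume `> 0` (Mathlib), `deg ≥ 1` (`deg_pos`), `c ≠ 0` (`maninConstant_ne_zero_holds`), `w_K ≥ 1`, `d_K ≠ 0`, and
`ĥ(P) ≠ 0` for non-torsion `P` (Silverman VIII.9.3 (d), a tree theorem). [folklore] -/
theorem LDerivEK_ne_zero_of_realDisplay
    (W : WeierstrassCurve ℚ) [W.IsElliptic] {N : ℕ} [NeZero N] (Dt : ModularParametrizationData W N)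
    (K : Type) [Field K] [NumberField K]
    {V₀ : WeierstrassCurve ℚ} [V₀.IsElliptic] {NV : ℕ} [NeZero NV] (D₀ : ModularParametrizationData V₀ NV)
    {P : (W.baseChange K).toAffine.Point} {degS : ℕ}
    (hdisp : (degS : ℂ) * LDerivEK W K =
      ((2 * ZLattice.covolume Dt.L.lattice * (D₀.modularDegree : ℝ) /
          ((D₀.c : ℝ) ^ 2 * ((Units.torsionOrder K : ℝ) / 2) ^ 2 * √|(NumberField.discr K : ℝ)|) *
        P.canonicalHeight : ℝ) : ℂ))
    (hnt : ¬ IsOfFinAddOrder P) : LDerivEK W K ≠ 0 := by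
  haveI hEK : (W.baseChange K).IsElliptic := by rw [WeierstrassCurve.baseChange]; infer_instance
  intro hL
  have hR : (2 * ZLattice.covolume Dt.L.lattice * (D₀.modularDegree : ℝ) /
      ((D₀.c : ℝ) ^ 2 * ((Units.torsionOrder K : ℝ) / 2) ^ 2 * √|(NumberField.discr K : ℝ)|)) *
        P.canonicalHeight = 0 := by
    have h := hdisp
    rw [hL, mul_zero] at h
    exact_mod_cast h.symm
  have hcov : 0 < ZLattice.covolume Dt.L.lattice := ZLattice.covolume_pos Dt.L.lattice MeasureTheory.volume
  have hdeg : (0 : ℝ) < (D₀.modularDegree : ℝ) := by exact_mod_cast D₀.deg_pos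
  have hc : (D₀.c : ℝ) ≠ 0 := by exact_mod_cast D₀.maninConstant_ne_zero_holds
  have hw : (0 : ℝ) < ((Units.torsionOrder K : ℝ) / 2) := by
    have : (0 : ℝ) < (Units.torsionOrder K : ℝ) := by exact_mod_cast Units.torsionOrder_pos K
    positivity
  have hd : (0 : ℝ) < √|(NumberField.discr K : ℝ)| := by
    apply Real.sqrt_pos.mpr
    have : (NumberField.discr K : ℝ) ≠ 0 := by exact_mod_cast NumberField.discr_ne_zero K
    exact abs_pos.mpr this
  have hC : (2 * ZLattice.covolume Dt.L.lattice * (D₀.modularDegree : ℝ) /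
      ((D₀.c : ℝ) ^ 2 * ((Units.torsionOrder K : ℝ) / 2) ^ 2 * √|(NumberField.discr K : ℝ)|)) ≠ 0 := by
    apply div_ne_zero
    · positivity
    · exact mul_ne_zero (mul_ne_zero (pow_ne_zero _ hc) (pow_ne_zero _ hw.ne')) hd.ne'
  have hh : P.canonicalHeight = 0 := by
    rcases mul_eq_zero.mp hR with h | h
    · exact absurd h hC
    · exact h
  exact hnt ((WeierstrassCurve.Affine.Point.canonicalHeight_eq_zero_iff_holds P).mp hh)

/-- **`0 < [E(K):ℤP]` from a real display**, GZK over `ℚ` and modularity: `L′(E/K,1) ≠ 0` (§2) gives `rank E(K) = 1`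
(`mordellWeilRank_baseChange_eq_one_of_LDerivEK_ne_zero`), and a non-torsion point of a rank-one finitely generated group
has finite index (`index_zmultiples_ne_zero_of_finrank_eq_one`). CONDITIONAL on `hGZK`, `hE`. [cite: BCDTJAMS2001, Thm. A]
[cite: SilvermanAEC2009, Thm. VIII.9.3] -/
theorem index_pos_of_realDisplay_of_GZK
    (hGZK : rank_eq_analyticRank_of_analyticRank_le_one) (hE : WeierstrassCurve.hasEntireLFunction_rat)
    (W : WeierstrassCurve ℚ) [W.IsElliptic] {N : ℕ} [NeZero N] (Dt : ModularParametrizationData W N)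
    (K : Type) [Field K] [NumberField K] (hK : IsImaginaryQuadratic K)
    {V₀ : WeierstrassCurve ℚ} [V₀.IsElliptic] {NV : ℕ} [NeZero NV] (D₀ : ModularParametrizationData V₀ NV)
    {P : (W.baseChange K).toAffine.Point} {degS : ℕ}
    (hdisp : (degS : ℂ) * LDerivEK W K =
      ((2 * ZLattice.covolume Dt.L.lattice * (D₀.modularDegree : ℝ) /
          ((D₀.c : ℝ) ^ 2 * ((Units.torsionOrder K : ℝ) / 2) ^ 2 * √|(NumberField.discr K : ℝ)|) *
        P.canonicalHeight : ℝ) : ℂ))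
    (hnt : ¬ IsOfFinAddOrder P) : 0 < (AddSubgroup.zmultiples P).index := by
  haveI hEK : (W.baseChange K).IsElliptic := by rw [WeierstrassCurve.baseChange]; infer_instance
  have hL : LDerivEK W K ≠ 0 := LDerivEK_ne_zero_of_realDisplay W Dt K D₀ hdisp hnt
  have hrK : (W.baseChange K).mordellWeilRank = 1 :=
    mordellWeilRank_baseChange_eq_one_of_LDerivEK_ne_zero W K hGZK hE hK.1 hL hnt
  haveI : AddGroup.FG (W.baseChange K).toAffine.Point := (W.baseChange K).addGroup_fg_point_holds
  exact Nat.pos_of_ne_zero (index_zmultiples_ne_zero_of_finrank_eq_one hnt hrK)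

/-! ## §3 The plain Kolyvagin order clause at `3` from the labels, on the partner frame -/

set_option maxHeartbeats 800000 in
/-- **THE PLAIN KOLYVAGIN ORDER CLAUSE AT `3` FROM THE LABELS.** Frame: `E = W/ℚ` globally minimal on the leaf (`Addv W 3`,
`SubGss W 3`: `E[3]` irreducible, `3 ∣ N` additive), `K` imaginary quadratic, a set `S` of MULTIPLICATIVE primes of `W` inert and
unramified in `K`, every other prime of `N` split in `K` (so `3 ∉ S` splits and `3 ∤ d_K`); a family `ys : m ↦ E(K[m])` with bottom
`P ∈ E(K)` carrying the labels (B2)–(B5) (`ShimuraWalk.LabelsAt`), and the index guard `P ∉ E(K)_tors ⇒ 0 < [E(K):ℤP]`. CONCLUSION: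
`P ∉ E(K)_tors ⇒ #Ш(E/K)[3^∞] ≤ 3^{2·ord₃[E(K):ℤP]}` — part R2's image-keyed refined bound at depth `t = 0` (its (DIV) clause is then
`3^M·B = 3^M·P_{k'}`, witnessed by `B := P_{k'}`), with the four mod-`3` image inputs from `kolyvaginImageInputs_three_of_not_dvd_discr`
and the Cassels–Tate level inputs from the Ш²-cochain bridge (a kernel theorem). CONDITIONAL on the labels; nothing booked.
[cite: McCallumLMS1991, §1 Theorem (Kolyvagin), §5 Cor. 5.6] [cite: GrossLMS1991, §3 Prop. 3.7, §4 (4.1), §5 Prop. 5.3]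
[cite: MatarNekovar2019, Thm. 0.7 (p. 456)] -/
theorem orderClause_of_labels
    (W : WeierstrassCurve ℚ) [W.IsElliptic] [W.IsGloballyMinimal] {N : ℕ} [NeZero N] (hN : W.conductorNorm ℤ = N)
    (hadd : Addv W 3) (hsub : SubGss W 3)
    (Dt : ModularParametrizationData W N)
    (K : Type) [Field K] [NumberField K] (hK : IsImaginaryQuadratic K) (S : Finset ℕ)
    (hSin : ∀ ℓ ∈ S, ∃ _ : Fact ℓ.Prime, W.HasMultiplicativeReductionAtPrime ℓ ∧
      ((Ideal.span {(ℓ : ℤ)}).primesOver (𝓞 K)).ncard = 1 ∧ ¬ (ℓ : ℤ) ∣ NumberField.discr K)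
    (hsp : ∀ ℓ : ℕ, ℓ.Prime → ℓ ∣ N → ℓ ∉ S → ((Ideal.span {(ℓ : ℤ)}).primesOver (𝓞 K)).ncard = 2)
    (ι : K →+* ℂ) (ys : (m : ℕ) → (W.baseChange (ringClassField K ι m)).toAffine.Point)
    {P : (W.baseChange K).toAffine.Point} {ε : ℤ}
    (hL : ShimuraWalk.LabelsAt W N K ι P ys ε)
    (hguard : ¬ IsOfFinAddOrder P → 0 < (AddSubgroup.zmultiples P).index)
    (hnt : ¬ IsOfFinAddOrder P) :
    Nat.card (AddCommGroup.primaryComponent (W.baseChange K).sha 3) ≤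
      3 ^ (2 * padicValNat 3 (AddSubgroup.zmultiples P).index) := by
  subst hN
  haveI h3F : Fact (Nat.Prime 3) := ⟨Nat.prime_three⟩
  have hp : (3 : ℕ).Prime := Nat.prime_three
  obtain ⟨hε, hB2, hB3, hB3K, hB4, hB5⟩ := hL
  have hirr : W.HasIrreducibleModPGaloisRep 3 := Additive.irr_of_subGss_of_ne_two W 3 (by decide) hadd hsub
  -- `3` is additive for `W`: `3 ∣ N`, `3 ∉ S` (the inert primes are multiplicative), so `3` splits and `3 ∤ d_K`
  have hbad3 : ¬ W.HasGoodReductionAtPrime 3 := not_good_of_addv W 3 hadd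
  have hnm3 : ¬ W.HasMultiplicativeReductionAtPrime 3 := not_mult_of_addv W 3 hadd
  have h3N : 3 ∣ W.conductorNorm ℤ := (W.dvd_conductorNorm_iff_not_hasGoodReductionAtPrime 3).mpr hbad3
  have h3S : 3 ∉ S := fun h ↦ by
    obtain ⟨_, hm, -⟩ := hSin 3 h
    exact hnm3 hm
  have hps2 : ((Ideal.span {((3 : ℕ) : ℤ)}).primesOver (𝓞 K)).ncard = 2 := hsp 3 hp h3N h3S
  have hps : SplitsIn K 3 := hps2
  have h3d : ¬ ((3 : ℕ) : ℤ) ∣ NumberField.discr K := not_dvd_discr_of_splitsIn hK.1 hp hps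
  -- the inert primes are `∥ N`
  have hin : ∀ ℓ ∈ S, ℓ.Prime ∧ ℓ ∣ W.conductorNorm ℤ ∧ ¬ ℓ ^ 2 ∣ W.conductorNorm ℤ ∧
      ((Ideal.span {(ℓ : ℤ)}).primesOver (𝓞 K)).ncard = 1 ∧ ¬ (ℓ : ℤ) ∣ NumberField.discr K := by
    intro ℓ hℓ
    obtain ⟨hℓF, hm, hn, hd⟩ := hSin ℓ hℓ
    have hℓN : ℓ ∣ W.conductorNorm ℤ :=
      (W.dvd_conductorNorm_iff_not_hasGoodReductionAtPrime ℓ).mpr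
        (WeierstrassCurve.HasMultiplicativeReduction.not_hasGoodReduction (R := ℤ_[ℓ]) hm)
    exact ⟨hℓF.out, hℓN, not_sq_dvd_conductorNorm_of_mult W ℓ hm, hn, hd⟩
  -- the four mod-`3` image inputs over `K` from `E[3]` irreducible and `3 ∤ d_K`
  obtain ⟨hIz, hIs, hIc, hIt⟩ :=
    ShimuraKolyvaginOfImage.kolyvaginImageInputs_three_of_not_dvd_discr K W S rfl hirr hK hin hsp h3d
  -- the Cassels–Tate level inputs: cell bsd-wall's Ш²-cochain bridge (a kernel theorem)
  have hCT : casselsTate_levelInputs K :=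
    ShaTwoCochainTheta.casselsTate_levelInputs_of_readout_vanishing_flip K
      (ShaTwoCochainTheta.hbridge_of_readout_criterion K
        (ShaTwoCochain.classBarInv_readout_eq_zero_of_criterion K))
  -- part R2 at depth `t = 0`
  have key :=
    ShimuraKolyvaginOfImage.padicValNat_card_sha_primary_add_le_of_shimuraLabels_ofImage_of_casselsTate_of_divLab_of_not_dvd_discr
      hCT rfl (by decide) hirr hK ι Dt hin hsp h3d hIz hIs hIc hIt ys hε hguard hB2 hB3 hB3K hB4 hB5 0
      (fun k M k' hk' hKol σ' H' instF f' h1 h2 h3' h4 ↦ ⟨_, by rw [Nat.sub_zero]; push_cast; rfl⟩) hnt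
  exact natCard_le_pow_of_padicValNat_le _ (by omega)

/-! ## §4 (DISPLAY) ⟸ (DISPLAY-L) ∧ GZK ∧ modularity -/

/-- **(DISPLAY) ⟸ (DISPLAY-L) ∧ GZK ∧ MODULARITY — the partner genus display's ORDER CLAUSE DISCHARGED.** Hypothesis `hDL` = the
body of the reshaped stub (DISPLAY-L) `Partnerdescent.PartnerGenusDisplayLabelledAtThree` (skeleton v4): on the partner frame (leaf
curve `W`, `3`-good twist partner `V` with its optimal datum `D₀`, field `K` with `d_K` odd, even inert multiplicative set `S`, the rest
of `N` split, `V`'s class-minimal Shimura datum `P₀`) THERE ARE `P ∈ E(K)`, `degS ≥ 1` with `ord₃ degS = ord₃ deg P₀`, the REAL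
display, AND a labelled `W`-family `(ι, ys, ε)` with bottom `P` (`ShimuraWalk.LabelsAt`). Conclusion = the body of the registered stub
(DISPLAY) `Partnerdescent.PartnerGenusDisplayAtThree` VERBATIM (same frame; display; order clause `P ∉ E(K)_tors ⇒ #Ш(E/K)[3^∞] ≤
3^{2·ord₃[E(K):ℤP]}`). Proof: §3 with the index guard of §2. CONDITIONAL on `hDL`, GZK, modularity; nothing booked; BSD not proved.
[cite: CaiShuTian2014, Thm. 1.5] [cite: GrossLMS1991, §3 Prop. 3.7, §5 Prop. 5.3] [cite: McCallumLMS1991, §1 Theorem (Kolyvagin)]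
[cite: MatarNekovar2019, Thm. 0.7 (p. 456)] -/
theorem partnerGenusDisplay_of_labelled_of_GZK_of_modularity
    (hGZK : rank_eq_analyticRank_of_analyticRank_le_one) (hE : WeierstrassCurve.hasEntireLFunction_rat)
    (hDL : ∀ (W : WeierstrassCurve ℚ) [W.IsElliptic] [W.IsGloballyMinimal] (N : ℕ) [NeZero N]
      (Dt : ModularParametrizationData W N),
      ¬ W.HasCM → Addv W 3 → SubGss W 3 → W.conductorNorm ℤ = N →
      ∀ (V : WeierstrassCurve ℚ) [V.IsElliptic] [V.IsGloballyMinimal] (CV : VariableChange ℚ),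
        CV • W.quadraticTwist (-3) = V →
      ∀ (NV : ℕ) [NeZero NV] (V₀ : WeierstrassCurve ℚ) [V₀.IsElliptic] [V₀.IsGloballyMinimal]
        (D₀ : ModularParametrizationData V₀ NV),
        V.conductorNorm ℤ = NV → IsNewformOf V D₀.f →
        (∀ (V₂ : WeierstrassCurve ℚ) [V₂.IsElliptic] (D₂ : ModularParametrizationData V₂ NV),
          D₂.f = D₀.f → D₀.modularDegree ≤ D₂.modularDegree) →
      ∀ (K : Type) [Field K] [NumberField K] (S : Finset ℕ)
        (X : ShimuraCurveData (∏ q ∈ S, q) (NV / ∏ q ∈ S, q))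
        (V' : WeierstrassCurve ℚ) [V'.IsElliptic] (P₀ : ShimuraParametrizationData X V'),
        IsImaginaryQuadratic K → Odd (NumberField.discr K) → Even S.card →
        (∀ ℓ ∈ S, ∃ _ : Fact ℓ.Prime, W.HasMultiplicativeReductionAtPrime ℓ ∧
          ((Ideal.span {(ℓ : ℤ)}).primesOver (𝓞 K)).ncard = 1 ∧ ¬ (ℓ : ℤ) ∣ NumberField.discr K) →
        (∀ ℓ : ℕ, ℓ.Prime → ℓ ∣ N → ℓ ∉ S → ((Ideal.span {(ℓ : ℤ)}).primesOver (𝓞 K)).ncard = 2) →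
        P₀.IsMinimalFor V →
        ∃ (P : (W.baseChange K).toAffine.Point) (degS : ℕ), 0 < degS ∧
          padicValNat 3 degS = padicValNat 3 P₀.deg ∧
          (degS : ℂ) * LDerivEK W K =
            ((2 * ZLattice.covolume Dt.L.lattice * (D₀.modularDegree : ℝ) /
                ((D₀.c : ℝ) ^ 2 * ((Units.torsionOrder K : ℝ) / 2) ^ 2 * √|(NumberField.discr K : ℝ)|) *
              P.canonicalHeight : ℝ) : ℂ) ∧
          ∃ (ι : K →+* ℂ) (ys : (m : ℕ) → (W.baseChange (ringClassField K ι m)).toAffine.Point) (ε : ℤ),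
            ShimuraWalk.LabelsAt W N K ι P ys ε) :
    ∀ (W : WeierstrassCurve ℚ) [W.IsElliptic] [W.IsGloballyMinimal] (N : ℕ) [NeZero N]
      (Dt : ModularParametrizationData W N),
      ¬ W.HasCM → Addv W 3 → SubGss W 3 → W.conductorNorm ℤ = N →
    ∀ (V : WeierstrassCurve ℚ) [V.IsElliptic] [V.IsGloballyMinimal] (CV : VariableChange ℚ),
      CV • W.quadraticTwist (-3) = V →
    ∀ (NV : ℕ) [NeZero NV] (V₀ : WeierstrassCurve ℚ) [V₀.IsElliptic] [V₀.IsGloballyMinimal]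
      (D₀ : ModularParametrizationData V₀ NV),
      V.conductorNorm ℤ = NV → IsNewformOf V D₀.f →
      (∀ (V₂ : WeierstrassCurve ℚ) [V₂.IsElliptic] (D₂ : ModularParametrizationData V₂ NV),
        D₂.f = D₀.f → D₀.modularDegree ≤ D₂.modularDegree) →
    ∀ (K : Type) [Field K] [NumberField K] (S : Finset ℕ)
      (X : ShimuraCurveData (∏ q ∈ S, q) (NV / ∏ q ∈ S, q))
      (V' : WeierstrassCurve ℚ) [V'.IsElliptic] (P₀ : ShimuraParametrizationData X V'),
      IsImaginaryQuadratic K → Odd (NumberField.discr K) → Even S.card →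
      (∀ ℓ ∈ S, ∃ _ : Fact ℓ.Prime, W.HasMultiplicativeReductionAtPrime ℓ ∧
        ((Ideal.span {(ℓ : ℤ)}).primesOver (𝓞 K)).ncard = 1 ∧ ¬ (ℓ : ℤ) ∣ NumberField.discr K) →
      (∀ ℓ : ℕ, ℓ.Prime → ℓ ∣ N → ℓ ∉ S → ((Ideal.span {(ℓ : ℤ)}).primesOver (𝓞 K)).ncard = 2) →
      P₀.IsMinimalFor V →
      ∃ (P : (W.baseChange K).toAffine.Point) (degS : ℕ), 0 < degS ∧
        padicValNat 3 degS = padicValNat 3 P₀.deg ∧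
        (degS : ℂ) * LDerivEK W K =
          ((2 * ZLattice.covolume Dt.L.lattice * (D₀.modularDegree : ℝ) /
              ((D₀.c : ℝ) ^ 2 * ((Units.torsionOrder K : ℝ) / 2) ^ 2 * √|(NumberField.discr K : ℝ)|) *
            P.canonicalHeight : ℝ) : ℂ) ∧
        (¬ IsOfFinAddOrder P →
          Nat.card (AddCommGroup.primaryComponent (W.baseChange K).sha 3) ≤
            3 ^ (2 * padicValNat 3 (AddSubgroup.zmultiples P).index)) := by
  intro W _ _ N _ Dt hCM hadd hsub hN V _ _ CV hV NV _ V₀ _ _ D₀ hNV hfV hminV K _ _ S X V' _ P₀ hK hodd hSeven hSin hsp hmin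
  obtain ⟨P, degS, h0, hv, hdisp, ι, ys, ε, hL⟩ :=
    hDL W N Dt hCM hadd hsub hN V CV hV NV V₀ D₀ hNV hfV hminV K S X V' P₀ hK hodd hSeven hSin hsp hmin
  exact ⟨P, degS, h0, hv, hdisp, fun hnt ↦
    orderClause_of_labels W hN hadd hsub Dt K hK S hSin hsp ι ys hL
      (index_pos_of_realDisplay_of_GZK hGZK hE W Dt K hK D₀ hdisp) hnt⟩

end Summit.BirchSwinnertonDyer.BirchSwinnertonDyer.Theorems.LeafPartnerDisplay

end
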